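import Summits.RiemannHypothesis.RiemannHypothesis.Theses.MayerPairing

/-!
# `UnitCircleCrossedOnce` (crux `stmt-RiemannHypothesis-1470`, route `MayerPairing`):
# read-back and load-bearing analysis of the inlined eigenvalue predicate (negative-side support)

Support file of the crux disprover (cdisprove seats refuter-cdisprove-stmt-RiemannHypothesis-1470-0 / -g2-0).
Proved here, `sorry`-free:

* `ucc_iff` / `not_ucc_iff` — the crux read through the named predicate `IsMayerEigenvalue`, and the exact
  shape of a refutation (a height `|τ| ≥ 7`, `0 < a < b < 1/2`, and ONE continuous eigenvalue selection of
  Mayer's `L_{σ+iτ}` on `[a,b]` with modulus `1` at both ends).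
* Load-bearing analysis — each of the three side clauses of the inlined predicate is necessary:
  `ucc_false_without_nonvanishing` (`f ≡ 0` makes every `μ` an eigenvalue),
  `ucc_false_without_delta_pos` (`δ = -1`: the junk eigenfunction `indicator {1}`),
  `ucc_false_without_tendsto` (NON-junk: the explicit solutions `f_s(z) = 1 - (z+1)^{-2s}` of the three-term
  equation with `μ = -1`, valid for every `s` — `three_term_trivial_solution`, via the branch identity
  `cpow_mul_cpow_div_eq`; this is Lewis–Zagier's trivial period-like function `1 - z^{-2s}` shifted by one,
  and `μ f - L_s f ≡ -1`, so only the normalisation clause removes it).  Consequently the bare three-term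
  equation has solutions for EVERY `μ` (`f = (μ - L_s)⁻¹ c`, `c` 1-periodic) and "unit circle crossed once"
  can only come from the spectral normalisation.
* `ucc_of_strictModulusMonotonicity` — the natural strengthening (strict σ-decrease of every eigenvalue
  modulus) implies the crux; it is recorded because it is NUMERICALLY FALSE (τ ≈ 28.0, 29.79, 18.4–18.9:
  see `Cruxes/UnitCircleCrossedOnce/Disproof.lean`), so provers must not route through it.

The crux itself is numerically FALSE (double unit-circle crossings of one continuous branch at τ = 24,
γ₉/2 and 37.85; three independent codes — evidence files on the item); that kill cannot be a Lean theorem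
(it needs genuine eigenfunctions of `L_s` along a σ-segment), see the Disproof work file.
-/

namespace Summit.RiemannHypothesis.RiemannHypothesis.Theorems.UnitCircleCrossedOnce.Negative

open Filter Topology Set
open Summit.RiemannHypothesis.RiemannHypothesis.Theses.MayerPairing

/-- The eigenvalue predicate inlined in every item of the route: "`μ` is an eigenvalue of Mayer's
continued transfer operator `L_s`", in the Lewis–Zagier/Chang–Mayer three-term form. -/
def IsMayerEigenvalue (s μ : ℂ) : Prop :=
  ∃ f : ℂ → ℂ, ∃ δ : ℝ, 0 < δ ∧ DifferentiableOn ℂ f {z : ℂ | -δ < z.re} ∧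
    (∃ z : ℂ, 0 < z.re ∧ f z ≠ 0) ∧
    (∀ z : ℂ, -δ < z.re → μ * (f z - f (z + 1)) = (z + 1) ^ (-(2 * s)) * f (1 / (z + 1))) ∧
    Tendsto (fun x : ℝ => μ * f x - f 0 * ((x : ℂ) + 1) ^ (1 - 2 * s) / (2 * s - 1)) atTop (𝓝 0)

/-- The crux, read through the named predicate (definitional unfolding only). -/
theorem ucc_iff :
    UnitCircleCrossedOnce ↔
      ∀ τ : ℝ, 7 ≤ |τ| → ∀ a b : ℝ, 0 < a → a < b → b < 1 / 2 → ∀ Λ : ℝ → ℂ,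
        ContinuousOn Λ (Icc a b) →
        (∀ σ ∈ Icc a b, IsMayerEigenvalue ((σ : ℂ) + (τ : ℂ) * Complex.I) (Λ σ)) →
        ¬ (‖Λ a‖ = 1 ∧ ‖Λ b‖ = 1) :=
  Iff.rfl

/-! ## A. Load-bearing analysis: hypotheses of the eigenvalue predicate that cannot be dropped -/

/-- The crux with the non-vanishing clause `∃ z, 0 < z.re ∧ f z ≠ 0` deleted from the predicate. -/
def WithoutNonvanishing : Prop :=
  ∀ τ : ℝ, 7 ≤ |τ| → ∀ a b : ℝ, 0 < a → a < b → b < 1 / 2 → ∀ Λ : ℝ → ℂ,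
    ContinuousOn Λ (Icc a b) →
    (∀ σ ∈ Icc a b, ∃ f : ℂ → ℂ, ∃ δ : ℝ, 0 < δ ∧ DifferentiableOn ℂ f {z : ℂ | -δ < z.re} ∧
      (∀ z : ℂ, -δ < z.re → Λ σ * (f z - f (z + 1)) =
        (z + 1) ^ (-(2 * ((σ : ℂ) + (τ : ℂ) * Complex.I))) * f (1 / (z + 1))) ∧
      Tendsto (fun x : ℝ => Λ σ * f x - f 0 * ((x : ℂ) + 1) ^ (1 - 2 * ((σ : ℂ) + (τ : ℂ) * Complex.I)) /
        (2 * ((σ : ℂ) + (τ : ℂ) * Complex.I) - 1)) atTop (𝓝 0)) →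
    ¬ (‖Λ a‖ = 1 ∧ ‖Λ b‖ = 1)

/-- Any proof of the crux must use the non-vanishing clause: without it `f ≡ 0` makes every `μ`
an "eigenvalue", so the constant selection `Λ ≡ 1` on `[1/8, 1/4]` at height `τ = 7` is admissible. -/
theorem ucc_false_without_nonvanishing : ¬ WithoutNonvanishing := by
  intro h
  have h7 : (7 : ℝ) ≤ |(7 : ℝ)| := by norm_num
  refine h 7 h7 (1 / 8) (1 / 4) (by norm_num) (by norm_num) (by norm_num) (fun _ => 1)
    continuousOn_const ?_ ⟨by simp, by simp⟩
  intro σ _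
  refine ⟨fun _ => 0, 1, one_pos, differentiableOn_const 0, ?_, ?_⟩
  · intro z _
    simp
  · simp

/-- The crux with the positivity `0 < δ` of the half-plane parameter deleted. -/
def WithoutDeltaPos : Prop :=
  ∀ τ : ℝ, 7 ≤ |τ| → ∀ a b : ℝ, 0 < a → a < b → b < 1 / 2 → ∀ Λ : ℝ → ℂ,
    ContinuousOn Λ (Icc a b) →
    (∀ σ ∈ Icc a b, ∃ f : ℂ → ℂ, ∃ δ : ℝ, DifferentiableOn ℂ f {z : ℂ | -δ < z.re} ∧
      (∃ z : ℂ, 0 < z.re ∧ f z ≠ 0) ∧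
      (∀ z : ℂ, -δ < z.re → Λ σ * (f z - f (z + 1)) =
        (z + 1) ^ (-(2 * ((σ : ℂ) + (τ : ℂ) * Complex.I))) * f (1 / (z + 1))) ∧
      Tendsto (fun x : ℝ => Λ σ * f x - f 0 * ((x : ℂ) + 1) ^ (1 - 2 * ((σ : ℂ) + (τ : ℂ) * Complex.I)) /
        (2 * ((σ : ℂ) + (τ : ℂ) * Complex.I) - 1)) atTop (𝓝 0)) →
    ¬ (‖Λ a‖ = 1 ∧ ‖Λ b‖ = 1)

/-- Any proof of the crux must use `0 < δ` (the eigenfunction has to be holomorphic on a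
neighbourhood of the CLOSED half-plane `Re z ≥ 0`, in particular at `0`): with `δ = -1` the domain is
`Re z > 1`, which misses the point `1`, its translates `z + 1` and its images `1/(z+1)`
(`|1/(z+1) - 1/4| < 1/4` there); so `f = indicator {1}` is a junk eigenfunction for every `μ`. -/
theorem ucc_false_without_delta_pos : ¬ WithoutDeltaPos := by
  intro h
  have h7 : (7 : ℝ) ≤ |(7 : ℝ)| := by norm_num
  refine h 7 h7 (1 / 8) (1 / 4) (by norm_num) (by norm_num) (by norm_num) (fun _ => 1)
    continuousOn_const ?_ ⟨by simp, by simp⟩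
  intro σ _
  refine ⟨Set.indicator {(1 : ℂ)} (fun _ => (1 : ℂ)), -1, ?_, ⟨1, by simp, by simp⟩, ?_, ?_⟩
  · -- on `Re z > 1` the function vanishes identically
    have hsub : ∀ z ∈ {z : ℂ | -(-1 : ℝ) < z.re}, Set.indicator {(1 : ℂ)} (fun _ => (1 : ℂ)) z = 0 := by
      intro z hz
      have hz' : (1 : ℝ) < z.re := by simpa using hz
      have hne : z ≠ 1 := by
        intro hz1
        rw [hz1, Complex.one_re] at hz'
        exact lt_irrefl _ hz'
      simp [hne]
    exact (differentiableOn_const (0 : ℂ)).congr hsub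
  · intro z hz
    have hz' : (1 : ℝ) < z.re := by simpa using hz
    have hne : z ≠ 1 := by
      intro hz1
      rw [hz1, Complex.one_re] at hz'
      exact lt_irrefl _ hz'
    have hne0 : z ≠ 0 := by
      intro hz0
      rw [hz0, Complex.zero_re] at hz'
      linarith
    have hne1 : z + 1 ≠ 1 := by
      intro h1
      exact hne0 (by linear_combination h1)
    simp [hne, hne1]
  · have h0 : Set.indicator {(1 : ℂ)} (fun _ => (1 : ℂ)) 0 = 0 := by simp
    rw [h0]
    apply tendsto_const_nhds.congr'
    filter_upwards [eventually_gt_atTop (1 : ℝ)] with x hx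
    have hne : (x : ℂ) ≠ 1 := by
      intro hx1
      have : x = 1 := by exact_mod_cast hx1
      linarith
    simp [hne]

section WithoutNormalisation

open Complex

/-- `(z+1)^w · ((z+2)/(z+1))^w = (z+2)^w` on the half-plane `Re z > -1` (principal branches: the
arguments of `z+1` and of `(z+2)/(z+1) = 1 + (z+1)⁻¹` both lie in `(-π/2, π/2)`, so no cut is
crossed).  The one analytic input of the trivial-solution computation below. -/
theorem cpow_mul_cpow_div_eq {z : ℂ} (hz : -1 < z.re) (w : ℂ) :
    (z + 1) ^ w * ((z + 2) / (z + 1)) ^ w = (z + 2) ^ w := by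
  have h1re : 0 < (z + 1).re := by simp; linarith
  have h1 : z + 1 ≠ 0 := fun h => by rw [h] at h1re; simp at h1re
  have h2re : 0 < (z + 2).re := by simp; linarith
  have h2 : z + 2 ≠ 0 := fun h => by rw [h] at h2re; simp at h2re
  set q : ℂ := (z + 2) / (z + 1) with hq
  have hq' : q = 1 + (z + 1)⁻¹ := by rw [hq]; field_simp; ring
  have hqre : 0 < q.re := by
    rw [hq', add_re, one_re, inv_re]
    have : 0 ≤ (z + 1).re / normSq (z + 1) := div_nonneg h1re.le (normSq_nonneg _)
    linarith
  have hq0 : q ≠ 0 := fun h => by rw [h] at hqre; simp at hqre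
  have harg : arg (z + 1) + arg q ∈ Set.Ioc (-Real.pi) Real.pi := by
    have ha := abs_arg_lt_pi_div_two_iff.2 (Or.inl h1re)
    have hb := abs_arg_lt_pi_div_two_iff.2 (Or.inl hqre)
    rw [abs_lt] at ha hb
    constructor <;> linarith [Real.pi_pos]
  have hlog : log ((z + 1) * q) = log (z + 1) + log q := (log_mul_eq_add_log_iff h1 hq0).2 harg
  have hprod : (z + 1) * q = z + 2 := by rw [hq]; field_simp
  rw [cpow_def_of_ne_zero h1, cpow_def_of_ne_zero hq0, cpow_def_of_ne_zero h2, ← Complex.exp_add,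
    ← hprod, hlog]
  ring_nf

/-- **The trivial solution.** `f_s(z) = 1 - (z+1)^{-2s}` solves the three-term equation of the
inlined predicate with `μ = -1`, for EVERY `s ∈ ℂ` and all `Re z > -1` (Lewis–Zagier's period-like
function `ψ(z) = 1 - z^{-2s}`, which satisfies `ψ(z) = ψ(z+1) + (z+1)^{-2s} ψ(z/(z+1))` and
`ψ(z) = -z^{-2s} ψ(1/z)`, shifted: `f = ψ(· + 1)`).  It is NOT an eigenfunction of `L_s`
(`L_s f = (z+1)^{-2s}`, so `μ f - L_s f ≡ -1`): only the normalisation clause of the predicate sees this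
(`f(0) = 0`, `μ f(x) → -1 ≠ 0`). -/
theorem three_term_trivial_solution (s : ℂ) {z : ℂ} (hz : -1 < z.re) :
    (-1 : ℂ) * ((1 - (z + 1) ^ (-(2 * s))) - (1 - (z + 1 + 1) ^ (-(2 * s)))) =
      (z + 1) ^ (-(2 * s)) * (1 - (1 / (z + 1) + 1) ^ (-(2 * s))) := by
  have h1re : 0 < (z + 1).re := by simp; linarith
  have h1 : z + 1 ≠ 0 := fun h => by rw [h] at h1re; simp at h1re
  have hq : 1 / (z + 1) + 1 = (z + 2) / (z + 1) := by field_simp; ring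
  have h2 : z + 1 + 1 = z + 2 := by ring
  rw [hq, h2]
  linear_combination cpow_mul_cpow_div_eq hz (-(2 * s))

/-- The crux with the normalisation clause `μ f(x) - f(0)(x+1)^{1-2s}/(2s-1) → 0` deleted from the
predicate (holomorphy, non-vanishing and the three-term equation kept). -/
def WithoutTendsto : Prop :=
  ∀ τ : ℝ, 7 ≤ |τ| → ∀ a b : ℝ, 0 < a → a < b → b < 1 / 2 → ∀ Λ : ℝ → ℂ,
    ContinuousOn Λ (Icc a b) →
    (∀ σ ∈ Icc a b, ∃ f : ℂ → ℂ, ∃ δ : ℝ, 0 < δ ∧ DifferentiableOn ℂ f {z : ℂ | -δ < z.re} ∧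
      (∃ z : ℂ, 0 < z.re ∧ f z ≠ 0) ∧
      (∀ z : ℂ, -δ < z.re → Λ σ * (f z - f (z + 1)) =
        (z + 1) ^ (-(2 * ((σ : ℂ) + (τ : ℂ) * Complex.I))) * f (1 / (z + 1)))) →
    ¬ (‖Λ a‖ = 1 ∧ ‖Λ b‖ = 1)

/-- Any proof of the crux must use the NORMALISATION clause: without it the constant unimodular
selection `Λ ≡ -1` on `[1/8, 1/4]` at height `τ = 7` is admissible, witnessed by the genuine
(non-junk) holomorphic solutions `f_s(z) = 1 - (z+1)^{-2s}` on `Re z > -1` (`δ = 1`), with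
`f_s(1) = 1 - 2^{-2s} ≠ 0` because `‖2^{-2s}‖ = 2^{-2σ} < 1`.  (So "unit-circle crossed once" is
not a property of the three-term equation; it can only come from the spectral normalisation.) -/
theorem ucc_false_without_tendsto : ¬ WithoutTendsto := by
  intro h
  have h7 : (7 : ℝ) ≤ |(7 : ℝ)| := by norm_num
  refine h 7 h7 (1 / 8) (1 / 4) (by norm_num) (by norm_num) (by norm_num) (fun _ => -1)
    continuousOn_const ?_ ⟨by simp, by simp⟩
  intro σ hσ
  have hσ0 : 0 < σ := by linarith [hσ.1]
  set w : ℂ := -(2 * ((σ : ℂ) + ((7 : ℝ) : ℂ) * Complex.I)) with hw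
  refine ⟨fun z => 1 - (z + 1) ^ w, 1, one_pos, ?_, ⟨1, by simp, ?_⟩, ?_⟩
  · -- holomorphy on `Re z > -1` (`z + 1` stays in the slit plane)
    intro z hz
    have hz' : -1 < z.re := by simpa using hz
    have hslit : z + 1 ∈ slitPlane := Or.inl (by simp; linarith)
    exact (((differentiableAt_id.add_const 1).cpow (differentiableAt_const w) hslit).const_sub
      1).differentiableWithinAt
  · -- `f 1 = 1 - 2^w ≠ 0` because `‖2^w‖ = 2^{-2σ} < 1`
    have h2 : (1 : ℂ) + 1 = ((2 : ℝ) : ℂ) := by norm_num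
    show (1 : ℂ) - (1 + 1) ^ w ≠ 0
    rw [h2, sub_ne_zero]
    intro h1
    have hn : ‖((2 : ℝ) : ℂ) ^ w‖ < 1 := by
      rw [norm_cpow_eq_rpow_re_of_pos (by norm_num : (0 : ℝ) < 2)]
      have hre : w.re = -(2 * σ) := by simp [hw]
      rw [hre]
      exact Real.rpow_lt_one_of_one_lt_of_neg (by norm_num) (by linarith)
    rw [← h1] at hn
    simp at hn
  · intro z hz
    have hz' : -1 < z.re := by simpa using hz
    simpa [hw] using three_term_trivial_solution ((σ : ℂ) + ((7 : ℝ) : ℂ) * Complex.I) hz'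

end WithoutNormalisation

/-! ## B. The natural strengthening "all moduli strictly decreasing" — implies the crux, but is
numerically FALSE (τ ≈ 28.0: a branch rises 0.6636 → 0.8870; τ ≈ 29.79: EP bump 1.53 → 1.72). -/

/-- STRICT σ-MONOTONICITY of eigenvalue moduli along every continuous eigenvalue selection
(the card's original MONOTONICITY; the regularity observed by job j000036 at 12 heights τ ≤ 18).
NUMERICALLY FALSE at τ = 28.00 (session refuter-cdisprove-…-1470-0, Chebyshev-interval kernel,
M = 80 and 120 agree) — see the module docstring; kept here as the statement provers must NOT
try to prove. -/
def StrictModulusMonotonicity : Prop :=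
  ∀ τ : ℝ, 7 ≤ |τ| → ∀ a b : ℝ, 0 < a → a < b → b < 1 / 2 → ∀ Λ : ℝ → ℂ,
    ContinuousOn Λ (Icc a b) →
    (∀ σ ∈ Icc a b, IsMayerEigenvalue ((σ : ℂ) + (τ : ℂ) * Complex.I) (Λ σ)) →
    StrictAntiOn (fun σ => ‖Λ σ‖) (Icc a b)

/-- The strengthening implies the crux (so its numerical failure does not touch the crux, but it
kills the "provable-for-large-τ monotonicity" programme suggested on the item). -/
theorem ucc_of_strictModulusMonotonicity (h : StrictModulusMonotonicity) : UnitCircleCrossedOnce := by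
  rw [ucc_iff]
  intro τ hτ a b ha hab hb Λ hΛ heig ⟨h1, h2⟩
  have hlt := h τ hτ a b ha hab hb Λ hΛ heig (left_mem_Icc.2 hab.le) (right_mem_Icc.2 hab.le) hab
  simp only [h1, h2, lt_self_iff_false] at hlt

/-! ## C. What a kill looks like (target shape for the evidence file)

`¬ UnitCircleCrossedOnce ↔ ∃ τ, 7 ≤ |τ| ∧ ∃ a b, 0 < a ∧ a < b ∧ b < 1/2 ∧ ∃ Λ, ContinuousOn Λ (Icc a b) ∧
  (∀ σ ∈ Icc a b, IsMayerEigenvalue (σ + τ I) (Λ σ)) ∧ ‖Λ a‖ = 1 ∧ ‖Λ b‖ = 1`.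
Numerically: a height τ and ONE tracked branch with |λ| = 1 at σ = a and σ = b (fold of the unit
level curve next to an exceptional point with |λ_EP| ≈ 1).  FOUND: τ = 37.85, a* ≈ 0.16930, b* ≈ 0.37696 (module docstring). -/

/-- The exact shape of a refutation of the crux: a height `|τ| ≥ 7`, `0 < a < b < 1/2` and one
continuous eigenvalue selection on `[a,b]` with modulus `1` at both endpoints. -/
theorem not_ucc_iff :
    ¬ UnitCircleCrossedOnce ↔
      ∃ τ : ℝ, 7 ≤ |τ| ∧ ∃ a b : ℝ, 0 < a ∧ a < b ∧ b < 1 / 2 ∧ ∃ Λ : ℝ → ℂ,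
        ContinuousOn Λ (Icc a b) ∧
        (∀ σ ∈ Icc a b, IsMayerEigenvalue ((σ : ℂ) + (τ : ℂ) * Complex.I) (Λ σ)) ∧
        ‖Λ a‖ = 1 ∧ ‖Λ b‖ = 1 := by
  rw [ucc_iff]
  push Not
  constructor
  · rintro ⟨τ, hτ, a, b, ha, hab, hb, Λ, hΛ, he, h1, h2⟩
    exact ⟨τ, hτ, a, b, ha, hab, hb, Λ, hΛ, he, h1, h2⟩
  · rintro ⟨τ, hτ, a, b, ha, hab, hb, Λ, hΛ, he, h1, h2⟩
    exact ⟨τ, hτ, a, b, ha, hab, hb, Λ, hΛ, he, h1, h2⟩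

end Summit.RiemannHypothesis.RiemannHypothesis.Theorems.UnitCircleCrossedOnce.Negative
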